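import Literature.AlgebraicGeometry.Frobenioids.AngularFrobenioids
import HarnessLib

/-!
# Frobenioids II, Example 3.3 (ii) on `C₀`, direction "isotropic ⇒ naively isotropic" (helper for the
# Theorem 3.6 discharges)

Mochizuki, *The geometry of Frobenioids II*, Kyushu J. Math. **62** (2008) 401–460, §3, Example 3.3 (ii)
p. 28 [cite: MochizukiFrdII2008, Ex 3.3 (ii) p.28]: "an object of `C` is isotropic [in the sense of
[FrdI], Definition 1.2, (iv)] if and only if it is naively isotropic". The full biconditional, and its
relative version over a base `D → D₀`, are abc-iut-L1-t6's (`Ex33ii_isotropic_iff`,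
`ArchimedeanIsotropy.lean`); this small file proves only what the Theorem 3.6 discharge files of
abc-iut-L1-t9 need on `C₀` itself, by the arrow `(id, 1, 1)` from an object to the isotropic object with
the same base and tip (`hullArrow`, an isometric pre-step): if it is an isomorphism — in particular if the
object is isotropic in the sense of [FrdI] Def. 1.2 (iv) — then the object is naively isotropic.
-/

namespace Literature.AlgebraicGeometry.Frobenioids

open CategoryTheory
open scoped Pointwise

namespace ArchFrd

namespace C0

/-- Components of the canonical decomposition ([FrdII] Def. 3.1 (ii)): `unitPart (z · r) = z` and
`|z · r| = r`. [cite: MochizukiFrdII2008, Def 3.1 (ii) p.24] -/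
theorem unitPart_mul_ofPosReal_eq (z : normOneSubgroup ℂ) (r : PosReal) :
    unitPart ℂ ((z : ℂˣ) * ofPosReal ℂ r) = z ∧ absHom ℂ ((z : ℂˣ) * ofPosReal ℂ r) = r := by
  have e := Prod.ext_iff.mp ((unitDecomposition ℂ).symm_apply_apply (z, r))
  exact ⟨e.1, e.2⟩

/-- The arrow `(id, 1, 1)` from an object of `C₀` to the isotropic object with the same base and tip (an
isotropic hull candidate; cf. [FrdI] Def. 1.3 (vii)). [cite: MochizukiFrdII2008, Ex 3.3 (ii) p.28] -/
noncomputable def hullArrow (X : C0) :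
    X ⟶ ⟨X.base, AngularRegion.isotropicOfTip X.region.tip,
      fun _ => AngularRegion.isIsotropic_isotropicOfTip _⟩ where
  base := 𝟙 X.base
  degFr := 1
  scalar := 1
  scalar_mem := one_mem _
  mapsTo := by
    rw [one_smul, PNat.one_coe, pow_one, pullRegion_id]
    intro u hu
    rw [mem_carrier_of_isIsotropic (AngularRegion.isIsotropic_isotropicOfTip _)]
    exact hu.2

/-- `hullArrow X` is an isometric pre-step (`ratio = tip/tip = 1`, base the identity, degree `1`).
[cite: MochizukiFrdII2008, Ex 3.3 (ii) p.28] -/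
theorem isIsometry_isPreStep_hullArrow (X : C0) :
    PreFrobenioid.IsIsometry C0.toElem (hullArrow X) ∧ PreFrobenioid.IsPreStep C0.toElem (hullArrow X) := by
  refine ⟨?_, rfl, ?_⟩
  · rw [A0.isIsometry_iff_norm_mul_tip_pow]
    change ‖((1 : ℂˣ) : ℂ)‖ * X.tip ^ ((1 : ℕ+) : ℕ) = X.tip
    rw [Units.val_one, norm_one, one_mul, PNat.one_coe, pow_one]
  · change IsIso (𝟙 X.base)
    infer_instance

/-- If `hullArrow X` is an isomorphism then `X` is naively isotropic: the inverse arrow (base identity,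
degree `1`, scalar `1`) maps every direction of `S¹` into the angular part of `X`.
[cite: MochizukiFrdII2008, Ex 3.3 (ii) p.28] -/
theorem isNaivelyIsotropic_of_isIso_hullArrow (X : C0) [IsIso (hullArrow X)] :
    X.IsNaivelyIsotropic := by
  set g := inv (hullArrow X) with hg
  -- the scalar of the inverse is `1`
  have hcomp : g ≫ hullArrow X = 𝟙 _ := IsIso.inv_hom_id (hullArrow X)
  have hbase : Base g = 𝟙 X.base := by
    have := congrArg Hom.base hcomp
    change Base g ≫ 𝟙 X.base = 𝟙 X.base at this
    rwa [Category.comp_id] at this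
  have hscalar : scalar g = 1 := by
    have := congrArg Hom.scalar hcomp
    change (Base g).act 1 * scalar g ^ ((1 : ℕ+) : ℕ) = 1 at this
    rwa [map_one, one_mul, PNat.one_coe, pow_one] at this
  -- every direction occurs in `X`
  apply Set.eq_univ_of_forall
  intro z
  have hmem : ((z : ℂˣ) * ofPosReal ℂ X.region.tip) ∈
      (AngularRegion.isotropicOfTip (K := ℂ) X.region.tip).carrier := by
    rw [mem_carrier_of_isIsotropic (AngularRegion.isIsotropic_isotropicOfTip _)]
    exact (unitPart_mul_ofPosReal_eq z X.region.tip).2.le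
  have h2 := (Hom.mapsTo g) (Set.smul_mem_smul_set (a := scalar g)
    (Set.pow_mem_pow hmem (n := (Hom.degFr g : ℕ))))
  have hdeg : Hom.degFr g = 1 := by
    have := congrArg Hom.degFr hcomp
    change Hom.degFr g * 1 = 1 at this
    rwa [mul_one] at this
  rw [hdeg, PNat.one_coe, pow_one, hscalar, one_smul] at h2
  change _ ∈ pullRegion X (Base g) at h2
  rw [hbase, pullRegion_id] at h2
  rw [← (unitPart_mul_ofPosReal_eq z X.region.tip).1]
  exact h2.1


/-- On `C₀`, isotropic in the sense of [FrdI] Def. 1.2 (iv) implies naively isotropic (apply isotropy to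
`hullArrow`). [cite: MochizukiFrdII2008, Ex 3.3 (ii) p.28] -/
theorem isNaivelyIsotropic_of_frobIsotropic (X : C0) (h : PreFrobenioid.IsIsotropic C0.toElem X) :
    X.IsNaivelyIsotropic := by
  obtain ⟨hi, hp⟩ := isIsometry_isPreStep_hullArrow X
  haveI : IsIso (hullArrow X) := h (hullArrow X) hi hp
  exact isNaivelyIsotropic_of_isIso_hullArrow X

end C0

end ArchFrd

end Literature.AlgebraicGeometry.Frobenioids
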